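import Literature.MathematicalPhysics.QuantumFieldTheory.Balaban1983to89.T3YM3TorusStatement
import Literature.MathematicalPhysics.QuantumFieldTheory.Balaban1983to89.T3ContinuumYM3TorusNonempty
import Literature.MathematicalPhysics.QuantumFieldTheory.Balaban1983to89.T3CovarianceRP
import Literature.MathematicalPhysics.QuantumFieldTheory.Balaban1983to89.T4ApexTwoLevel
import Literature.MathematicalPhysics.QuantumFieldTheory.Balaban1983to89.T4GenFunBounds
import Literature.MathematicalPhysics.QuantumFieldTheory.LatticeLangevinDynamics
import Literature.MathematicalPhysics.QuantumLattice.RepLieAlgebraUnitary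
import Literature.Analysis.FunctionSpaces.CsiszarKullbackPinsker
import Mathlib.InformationTheory.KullbackLeibler.Basic
import HarnessLib

/-!
# Route `ColdStartUniversality`, crux K_A1 `UniformColdStartMixing` (stmt-QuantumFields-24809), line
# `cold_entropy`: the node `stub_pinskerStep` — entropy budget + dissipation ⇒ K-uniform pointwise mixing

Helper file (seat `ym-line-csu-p1`; a `--supports 24809` node of the planner's line «cold_entropy», registered
stub `stub_pinskerStep`, statement `PinskerStep : ColdEntropyBudget → EntropyDissipation → PointwiseMixing` with the
skeleton's local abbreviations (`G2`, `su2Rep`, `avSU`, `toField`, `obsK`, `eqExpect`, `IsColdStartSol`, `gibbsK`,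
`lawAt`, `entAt`) unfolded, so that `stub_pinskerStep := pinskerStep` elaborates by unfolding).

Contents:

* `abs_integral_sub_integral_le_sqrt_two_mul_klDiv` — **Pinsker's inequality for Mathlib's `InformationTheory.klDiv`**
  in the form every entropy line consumes: for probability measures `μ, ν` with `klDiv μ ν < ∞` and a measurable
  observable `|f| ≤ 1`, `|∫ f dμ − ∫ f dν| ≤ √(2 · klDiv μ ν)`.  Proof: `μ ≪ ν` with density `p = dμ/dν`,
  `∫ f dμ − ∫ f dν = ∫ (p − 1) f dν`, `|·| ≤ ∫ |p − 1| dν ≤ √(2 ∫ p log p dν)` by the tree's density-form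
  Csiszár–Kullback–Pinsker inequality (`Literature.Analysis.FunctionSpaces.integral_abs_sub_le_sqrt`,
  Boucheron–Lugosi–Massart Thm 4.19), and `∫ p log p dν = klDiv μ ν` for probability measures.
* `abs_expectAt_sub_integral_le_of_klDiv_le` — one cut-off, one solution, one time: if the law of the pulled-back
  link field `b ↦ U_t(b.src, b.dir)` has `klDiv (law ‖ gibbsMeasure (F.P K) β_K) ≤ η²/2`, then
  `|expectAt K os − E[∏_{C∈os} avgObs K C (U_t)]| ≤ η` (`expectAt = ∫ ∏ avgObs d(gibbsMeasure)`,
  `T4GenFunBounds.expectAt_eq_integral_gibbs`; `|∏ avgObs| ≤ 1`; change of variables `integral_map`, the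
  measurability of `U_t` being the adaptedness clause of `IsSolution`).
* `pinskerStep` — the registered statement: ONE `γ₁ := min`, ONE `K₀ := max`, `T_c := s₀ + T(H₀, η²/2)`.

No definition, no sorry.  RECORD-rung R3 plumbing; the analytic content of the line (the K-uniform budget and the
K-uniform dissipation) is HYPOTHESIS here — this proves nothing about K_A1 itself or the mass gap. -/

set_option autoImplicit false

noncomputable section

namespace Summit.QuantumFields.YangMills.Theorems.ColdStartUniversality

open MeasureTheory ProbabilityTheory InformationTheory
open scoped NNReal ENNReal
open Literature.MathematicalPhysics.QuantumFieldTheory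
open Literature.MathematicalPhysics.QuantumLattice (fundamentalRep fundamentalLatticeRep continuous_fundamentalRep)
open Literature.MathematicalPhysics.QuantumFieldTheory.Balaban1983to89

/-! ### Pinsker's inequality for `InformationTheory.klDiv` -/

/-- **Pinsker's inequality, `klDiv` form.**  For probability measures `μ`, `ν` with finite Kullback–Leibler
divergence `klDiv μ ν` and a measurable observable bounded by `1`,
`|∫ f dμ − ∫ f dν| ≤ √(2 · (klDiv μ ν).toReal)` (i.e. `‖μ − ν‖_TV ≤ √(KL/2)` tested on `|f| ≤ 1`).
[cite: BoucheronLugosiMassart2013, §4.11 Thm. 4.19] -/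
theorem abs_integral_sub_integral_le_sqrt_two_mul_klDiv {α : Type*} [MeasurableSpace α]
    {μ ν : Measure α} [IsProbabilityMeasure μ] [IsProbabilityMeasure ν]
    (hkl : klDiv μ ν ≠ ∞) {f : α → ℝ} (hfm : Measurable f) (hfb : ∀ x, |f x| ≤ 1) :
    |(∫ x, f x ∂μ) - ∫ x, f x ∂ν| ≤ Real.sqrt (2 * (klDiv μ ν).toReal) := by
  obtain ⟨hac, hint⟩ := klDiv_ne_top_iff.mp hkl
  set p : α → ℝ := fun x => (μ.rnDeriv ν x).toReal with hp
  have hp0 : ∀ x, 0 ≤ p x := fun x => ENNReal.toReal_nonneg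
  have hpi : Integrable p ν := Measure.integrable_toReal_rnDeriv
  have h1i : Integrable (fun _ : α => (1 : ℝ)) ν := integrable_const 1
  have hfn : ∀ x, ‖f x‖ ≤ 1 := fun x => by rw [Real.norm_eq_abs]; exact hfb x
  have hfiν : Integrable f ν := Integrable.mono' h1i hfm.aestronglyMeasurable (ae_of_all _ hfn)
  -- `∫ f dμ = ∫ p f dν`
  have hpf : Integrable (fun x => p x * f x) ν :=
    hpi.mul_bdd hfm.aestronglyMeasurable (ae_of_all _ hfn)
  have hμf : ∫ x, f x ∂μ = ∫ x, p x * f x ∂ν := (integral_toReal_rnDeriv_mul hac).symm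
  -- masses
  have hmass : ∫ x, p x ∂ν = ∫ x, (1 : ℝ) ∂ν := by
    rw [hp, Measure.integral_toReal_rnDeriv hac, integral_const, smul_eq_mul, mul_one, probReal_univ,
      probReal_univ]
  -- `∫ p log p dν = KL`
  have hplog : Integrable (fun x => p x * Real.log (p x / 1)) ν := by
    simp only [div_one]
    exact (integrable_rnDeriv_mul_log_iff hac).mpr hint
  have hKL : (klDiv μ ν).toReal = ∫ x, p x * Real.log (p x / 1) ∂ν := by
    simp only [div_one]
    rw [toReal_klDiv_of_measure_eq hac (by simp), ← integral_toReal_rnDeriv_mul hac]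
    rfl
  -- Csiszár–Kullback–Pinsker in density form (tree)
  have hPin := Literature.Analysis.FunctionSpaces.integral_abs_sub_le_sqrt hp0 (fun _ => one_pos) hpi h1i
    hplog hmass
  rw [integral_const, smul_eq_mul, mul_one, probReal_univ, mul_one, ← hKL] at hPin
  -- `|∫ (p-1) f| ≤ ∫ |p - 1|`
  have hdiff : (∫ x, f x ∂μ) - ∫ x, f x ∂ν = ∫ x, (p x - 1) * f x ∂ν := by
    rw [hμf, ← integral_sub hpf hfiν]
    refine integral_congr_ae (ae_of_all _ fun x => ?_)
    simp only
    ring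
  rw [hdiff]
  calc |∫ x, (p x - 1) * f x ∂ν| ≤ ∫ x, |(p x - 1) * f x| ∂ν := abs_integral_le_integral_abs
    _ ≤ ∫ x, |p x - 1| ∂ν := by
        refine integral_mono_of_nonneg (ae_of_all _ fun x => abs_nonneg _) ((hpi.sub h1i).abs)
          (ae_of_all _ fun x => ?_)
        simp only
        rw [abs_mul]
        exact mul_le_of_le_one_right (abs_nonneg _) (hfb x)
    _ ≤ Real.sqrt (2 * (klDiv μ ν).toReal) := hPin

/-! ### One cut-off, one solution, one time: entropy bound ⇒ loop-string expectation bound -/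

/-- **From an entropy bound to a loop-string bound** at a fixed step `K`, time `t` and solution `U`: if the law of
the pulled-back link field `b ↦ U_t(b.src, b.dir)` under `P` has Kullback–Leibler divergence `≤ η²/2` with
respect to Bałaban's step-`K` Gibbs measure at `β_K = (γ ε_K)⁻¹` (`γ > 0`), then
`|expectAt K os − E[∏_{C∈os} avgObs K C (U_t)]| ≤ η`.  (Pinsker + `|∏ avgObs| ≤ 1` + `expectAt = ∫ · d(gibbsMeasure)`
+ change of variables; `U_t` is measurable by the adaptedness clause of `IsSolution`.) [folklore] -/
theorem abs_expectAt_sub_integral_le_of_klDiv_le (F : T3ContinuumYM3Torus.T3Family) {γ : ℝ} (hγ : 0 < γ)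
    (K : ℕ) (os : List (T3ContinuumYM3Torus.ULoop3 F)) {Ω : Type} [MeasurableSpace Ω] (P : Measure Ω)
    [IsProbabilityMeasure P] (W : ℝ≥0 → Ω → (Edge 3 ((F.P K).sitesPerDir 0) × NoiseIdx 2 → ℝ))
    (hW : IsFlatBrownian W P)
    (U : ℝ≥0 → Ω → GaugeConfig 3 ((F.P K).sitesPerDir 0) (Matrix.specialUnitaryGroup (Fin 2) ℂ))
    (hsol : (latticeLangevinDynamics (⟨2, fundamentalRep (Fin 2), continuous_fundamentalRep _,
        Literature.MathematicalPhysics.QuantumLattice.fundamentalRep_injective _,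
        Literature.MathematicalPhysics.QuantumLattice.fundamentalRep_mem_unitaryGroup⟩ :
        LatticeRep (Matrix.specialUnitaryGroup (Fin 2) ℂ)) ((γ * (F.P K).eps)⁻¹ / 2)).IsSolution
      (fundamentalRep (Fin 2)) hW.natFiltration P W U)
    (t : ℝ≥0) {η : ℝ} (hη : 0 < η)
    (hent : klDiv (Measure.map (fun ω => (fun b : PBond (F.P K) 0 => U t ω (b.src, b.dir) :
          GaugeField (F.P K) 0 (Matrix.specialUnitaryGroup (Fin 2) ℂ))) P)
        (T4GenFunBounds.gibbsMeasure (F.P K)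
          ((F.scheme (ExpMeanLog.expMeanLogSU : LoopAverage (Matrix.specialUnitaryGroup (Fin 2) ℂ)) γ).β K))
      ≤ ENNReal.ofReal (η ^ 2 / 2)) :
    |(F.scheme (ExpMeanLog.expMeanLogSU : LoopAverage (Matrix.specialUnitaryGroup (Fin 2) ℂ)) γ).expectAt K os -
        ∫ ω, (os.map fun C => F.avgObs (ExpMeanLog.expMeanLogSU :
            LoopAverage (Matrix.specialUnitaryGroup (Fin 2) ℂ)) K C
          (fun b : PBond (F.P K) 0 => U t ω (b.src, b.dir))).prod ∂P| ≤ η := by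
  set S := F.scheme (ExpMeanLog.expMeanLogSU : LoopAverage (Matrix.specialUnitaryGroup (Fin 2) ℂ)) γ with hS
  have hβ : ∀ K', 0 ≤ S.β K' := fun K' => F.scheme_β_nonneg _ hγ.le K'
  haveI := T4GenFunBounds.isProbabilityMeasure_gibbsMeasure (G := Matrix.specialUnitaryGroup (Fin 2) ℂ)
    (F.P K) (hβ K)
  -- the pushed-forward link field is measurable (adaptedness of the solution)
  have hmU : Measurable (U t) := (hsol.adapted t).mono (hW.natFiltration.le t) le_rfl
  have hΦ : Measurable fun V : GaugeConfig 3 ((F.P K).sitesPerDir 0) (Matrix.specialUnitaryGroup (Fin 2) ℂ) =>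
      (fun b : PBond (F.P K) 0 => V (b.src, b.dir) : GaugeField (F.P K) 0 (Matrix.specialUnitaryGroup (Fin 2) ℂ)) :=
    measurable_pi_lambda _ fun b => measurable_pi_apply _
  set X : Ω → GaugeField (F.P K) 0 (Matrix.specialUnitaryGroup (Fin 2) ℂ) :=
    fun ω => (fun b : PBond (F.P K) 0 => U t ω (b.src, b.dir)) with hX
  have hXm : Measurable X := hΦ.comp hmU
  haveI : IsProbabilityMeasure (Measure.map X P) := Measure.isProbabilityMeasure_map hXm.aemeasurable
  -- the observable
  set f : GaugeField (F.P K) 0 (Matrix.specialUnitaryGroup (Fin 2) ℂ) → ℝ :=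
    fun V => (os.map fun C => F.avgObs (ExpMeanLog.expMeanLogSU :
        LoopAverage (Matrix.specialUnitaryGroup (Fin 2) ℂ)) K C V).prod with hf
  have hm : ∀ K' C, Measurable (S.obs K' C) := fun K' C =>
    F.measurable_avgObs (F.avgMeasurable_of_measurableE _ T4ApexTwoLevel.measurableE_expMeanLogSU) K' C
  have hfm : Measurable f := T4GenFunBounds.measurable_prodObs S hm K os
  have hfb : ∀ V, |f V| ≤ 1 := fun V =>
    T4GenFunBounds.abs_prodObs_le_one S (fun K' C U => F.abs_avgObs_le_one _ K' C U) K os V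
  -- `expectAt = ∫ f d(gibbs)`
  have hE : S.expectAt K os = ∫ V, f V ∂(T4GenFunBounds.gibbsMeasure (F.P K) (S.β K)) :=
    T4GenFunBounds.expectAt_eq_integral_gibbs S hβ K os
  -- `E f(X) = ∫ f d(map X P)`
  have hI : (∫ ω, f (X ω) ∂P) = ∫ V, f V ∂(Measure.map X P) :=
    (integral_map hXm.aemeasurable hfm.aestronglyMeasurable).symm
  -- Pinsker
  have hkl : klDiv (Measure.map X P) (T4GenFunBounds.gibbsMeasure (F.P K) (S.β K)) ≠ ∞ :=
    ne_top_of_le_ne_top ENNReal.ofReal_ne_top hent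
  have hKL : (klDiv (Measure.map X P) (T4GenFunBounds.gibbsMeasure (F.P K) (S.β K))).toReal ≤ η ^ 2 / 2 :=
    ENNReal.toReal_le_of_le_ofReal (by positivity) hent
  have hPin := abs_integral_sub_integral_le_sqrt_two_mul_klDiv hkl hfm hfb
  have hfX : (fun ω => (os.map fun C => F.avgObs (ExpMeanLog.expMeanLogSU :
      LoopAverage (Matrix.specialUnitaryGroup (Fin 2) ℂ)) K C
        (fun b : PBond (F.P K) 0 => U t ω (b.src, b.dir))).prod) = fun ω => f (X ω) := rfl
  rw [hfX, hE, hI, abs_sub_comm]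
  calc |(∫ V, f V ∂(Measure.map X P)) - ∫ V, f V ∂(T4GenFunBounds.gibbsMeasure (F.P K) (S.β K))|
        ≤ Real.sqrt (2 * (klDiv (Measure.map X P) (T4GenFunBounds.gibbsMeasure (F.P K) (S.β K))).toReal) := hPin
    _ ≤ Real.sqrt (2 * (η ^ 2 / 2)) := Real.sqrt_le_sqrt (by linarith)
    _ = η := by rw [show 2 * (η ^ 2 / 2) = η ^ 2 by ring, Real.sqrt_sq hη.le]

/-! ### The registered node `PinskerStep` -/

/-- **`PinskerStep` (registered stub `stub_pinskerStep` of line «cold_entropy», stmt-QuantumFields-24809)**: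
the K-uniform cold-start ENTROPY BUDGET at a positive flow time (`ColdEntropyBudget`) and the K-uniform ENTROPY
DISSIPATION along the cold-start flow (`EntropyDissipation`) imply K-uniform POINTWISE MIXING of every loop
string (`PointwiseMixing`, the node shared with lines `birth`/`unitscale_coupling`): with ONE `γ₁ := min`, ONE
`K₀ := max` and `T_c := s₀ + T(H₀, η²/2)`, the entropy at every time `s ≥ T_c` is `≤ η²/2`, and Pinsker turns it into
`|expectAt K os − E[∏ avgObs (U(s/ε_K))]| ≤ η`.  Statement = the skeleton's, local abbreviations unfolded. [folklore] -/
theorem pinskerStep :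
    (∃ γ₁ : ℝ, 0 < γ₁ ∧ ∀ (F : T3ContinuumYM3Torus.T3Family) (γ : ℝ), 0 < γ → γ ≤ γ₁ →
      ∃ s₀ H₀ : ℝ, 0 < s₀ ∧ 0 ≤ H₀ ∧ ∃ K₀ : ℕ, ∀ K : ℕ, K₀ ≤ K →
        ∀ (Ω : Type) (mΩ : MeasurableSpace Ω) (P : Measure Ω) (_ : IsProbabilityMeasure P)
          (W : ℝ≥0 → Ω → (Edge 3 ((F.P K).sitesPerDir 0) × NoiseIdx 2 → ℝ)) (hW : IsFlatBrownian W P)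
          (U : ℝ≥0 → Ω → GaugeConfig 3 ((F.P K).sitesPerDir 0) (Matrix.specialUnitaryGroup (Fin 2) ℂ)),
          ((∀ ω, U 0 ω = fun _ => 1) ∧
            (latticeLangevinDynamics (⟨2, fundamentalRep (Fin 2), continuous_fundamentalRep _,
                Literature.MathematicalPhysics.QuantumLattice.fundamentalRep_injective _,
                Literature.MathematicalPhysics.QuantumLattice.fundamentalRep_mem_unitaryGroup⟩ :
                LatticeRep (Matrix.specialUnitaryGroup (Fin 2) ℂ)) ((γ * (F.P K).eps)⁻¹ / 2)).IsSolution
              (fundamentalRep (Fin 2)) hW.natFiltration P W U) →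
            klDiv (Measure.map (fun ω => (fun b : PBond (F.P K) 0 => U (s₀ / (F.P K).eps).toNNReal ω (b.src, b.dir) :
                  GaugeField (F.P K) 0 (Matrix.specialUnitaryGroup (Fin 2) ℂ))) P)
                (T4GenFunBounds.gibbsMeasure (F.P K)
                  ((F.scheme (ExpMeanLog.expMeanLogSU : LoopAverage (Matrix.specialUnitaryGroup (Fin 2) ℂ)) γ).β K))
              ≤ ENNReal.ofReal H₀) →
    (∃ γ₁ : ℝ, 0 < γ₁ ∧ ∀ (F : T3ContinuumYM3Torus.T3Family) (γ : ℝ), 0 < γ → γ ≤ γ₁ →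
      ∀ (H₀ η : ℝ), 0 ≤ H₀ → 0 < η →
        ∃ T : ℝ, 0 < T ∧ ∃ K₀ : ℕ, ∀ K : ℕ, K₀ ≤ K →
          ∀ (Ω : Type) (mΩ : MeasurableSpace Ω) (P : Measure Ω) (_ : IsProbabilityMeasure P)
            (W : ℝ≥0 → Ω → (Edge 3 ((F.P K).sitesPerDir 0) × NoiseIdx 2 → ℝ)) (hW : IsFlatBrownian W P)
            (U : ℝ≥0 → Ω → GaugeConfig 3 ((F.P K).sitesPerDir 0) (Matrix.specialUnitaryGroup (Fin 2) ℂ)),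
            ((∀ ω, U 0 ω = fun _ => 1) ∧
              (latticeLangevinDynamics (⟨2, fundamentalRep (Fin 2), continuous_fundamentalRep _,
                  Literature.MathematicalPhysics.QuantumLattice.fundamentalRep_injective _,
                  Literature.MathematicalPhysics.QuantumLattice.fundamentalRep_mem_unitaryGroup⟩ :
                  LatticeRep (Matrix.specialUnitaryGroup (Fin 2) ℂ)) ((γ * (F.P K).eps)⁻¹ / 2)).IsSolution
                (fundamentalRep (Fin 2)) hW.natFiltration P W U) →
              ∀ t₀ : ℝ, 0 ≤ t₀ →
                klDiv (Measure.map (fun ω => (fun b : PBond (F.P K) 0 => U (t₀ / (F.P K).eps).toNNReal ω (b.src, b.dir) :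
                      GaugeField (F.P K) 0 (Matrix.specialUnitaryGroup (Fin 2) ℂ))) P)
                    (T4GenFunBounds.gibbsMeasure (F.P K)
                      ((F.scheme (ExpMeanLog.expMeanLogSU : LoopAverage (Matrix.specialUnitaryGroup (Fin 2) ℂ)) γ).β K))
                  ≤ ENNReal.ofReal H₀ →
                ∀ s : ℝ, t₀ + T ≤ s →
                  klDiv (Measure.map (fun ω => (fun b : PBond (F.P K) 0 => U (s / (F.P K).eps).toNNReal ω (b.src, b.dir) :
                        GaugeField (F.P K) 0 (Matrix.specialUnitaryGroup (Fin 2) ℂ))) P)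
                      (T4GenFunBounds.gibbsMeasure (F.P K)
                        ((F.scheme (ExpMeanLog.expMeanLogSU : LoopAverage (Matrix.specialUnitaryGroup (Fin 2) ℂ)) γ).β K))
                    ≤ ENNReal.ofReal η) →
    (∃ γ₁ : ℝ, 0 < γ₁ ∧ ∀ (F : T3ContinuumYM3Torus.T3Family) (γ : ℝ), 0 < γ → γ ≤ γ₁ →
      ∀ (os : List (T3ContinuumYM3Torus.ULoop3 F)) (η : ℝ), 0 < η →
        ∃ Tc : ℝ, 0 < Tc ∧ ∃ K₀ : ℕ, ∀ K : ℕ, K₀ ≤ K →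
          ∀ (Ω : Type) (mΩ : MeasurableSpace Ω) (P : Measure Ω) (_ : IsProbabilityMeasure P)
            (W : ℝ≥0 → Ω → (Edge 3 ((F.P K).sitesPerDir 0) × NoiseIdx 2 → ℝ)) (hW : IsFlatBrownian W P)
            (U : ℝ≥0 → Ω → GaugeConfig 3 ((F.P K).sitesPerDir 0) (Matrix.specialUnitaryGroup (Fin 2) ℂ)),
            ((∀ ω, U 0 ω = fun _ => 1) ∧
              (latticeLangevinDynamics (⟨2, fundamentalRep (Fin 2), continuous_fundamentalRep _,
                  Literature.MathematicalPhysics.QuantumLattice.fundamentalRep_injective _,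
                  Literature.MathematicalPhysics.QuantumLattice.fundamentalRep_mem_unitaryGroup⟩ :
                  LatticeRep (Matrix.specialUnitaryGroup (Fin 2) ℂ)) ((γ * (F.P K).eps)⁻¹ / 2)).IsSolution
                (fundamentalRep (Fin 2)) hW.natFiltration P W U) →
              ∀ s : ℝ, Tc ≤ s →
                |(F.scheme (ExpMeanLog.expMeanLogSU : LoopAverage (Matrix.specialUnitaryGroup (Fin 2) ℂ)) γ).expectAt
                      K os -
                    ∫ ω, (os.map fun C => F.avgObs (ExpMeanLog.expMeanLogSU :
                        LoopAverage (Matrix.specialUnitaryGroup (Fin 2) ℂ)) K C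
                      (fun b : PBond (F.P K) 0 => U (s / (F.P K).eps).toNNReal ω (b.src, b.dir))).prod ∂P| ≤ η) := by
  rintro ⟨γa, hγa, hB⟩ ⟨γb, hγb, hD⟩
  refine ⟨min γa γb, lt_min hγa hγb, fun F γ hγ hγle os η hη => ?_⟩
  obtain ⟨s₀, H₀, hs₀, hH₀, Ka, hKa⟩ := hB F γ hγ (hγle.trans (min_le_left _ _))
  obtain ⟨T, hT, Kb, hKb⟩ := hD F γ hγ (hγle.trans (min_le_right _ _)) H₀ (η ^ 2 / 2) hH₀ (by positivity)
  refine ⟨s₀ + T, by positivity, max Ka Kb, fun K hK Ω mΩ P hP W hW U hU s hs => ?_⟩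
  have hbud := hKa K ((le_max_left _ _).trans hK) Ω mΩ P hP W hW U hU
  have hent := hKb K ((le_max_right _ _).trans hK) Ω mΩ P hP W hW U hU s₀ hs₀.le hbud s hs
  exact abs_expectAt_sub_integral_le_of_klDiv_le F hγ K os P W hW U hU.2 _ hη hent

end Summit.QuantumFields.YangMills.Theorems.ColdStartUniversality

end
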